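import Summits.AtomisticToContinuum.Crystallization.Theorems.OverbindingBudgetRecurrentSealStatements

/-!
# OverbindingBudget — node «RecurrentDust», statements: the recurrent normal forms of laws 5 and 3, hull bookkeeping, covariance
(decomp-a2c lens 4 «minimal counterexample / extremal reduction», generation 22; helper `--supports stmt-AtomisticToContinuum-31280`;
part of the node «RecurrentDust», whose statement and reading are in `…Theorems.OverbindingBudgetRecurrentDust`)

§K the limit-stable forms of the hypotheses of law 5 (`…MinimalCone.DustLaw` = `stub_dustChargeLaw`) and law 3
(`…MinimalCone.DislocationLaw` = `stub_dislocationDensityLaw`): `ThinCoresL` (loosened-clean Barlow sites `r`-dense at every loosening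
`s ∈ (0, 1/100)`), `Developable` / `BurgersFree` (verbatim the developability clause), `UnsealedL` (linkage of robustly clean pairs closer
than `W` at every loosening beyond their margin), `ViolatorsL` (robust violators at every margin below `t`), `BurgersDenseL`; the two laws on
their extremal class `RecurrentDustLaw`, `RecurrentDislocationLaw` (rooted, uniformly recurrent textures; no `MAT`); the hull families
`HullDust`, `HullBurgers`.  §L margins and the passage from the registered clauses to the limit-stable ones.  §M translation covariance.
The reductions `RecurrentDustLaw → DustLaw`, `RecurrentDislocationLaw → DislocationLaw` are `…OverbindingBudgetRecurrentDust` /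
`…OverbindingBudgetRecurrentBurgers`.
-/

noncomputable section

namespace Summit.AtomisticToContinuum.Crystallization.Theorems.OverbindingBudgetRecurrentDustStatements

open Filter Metric Set Topology
open Literature.MathematicalPhysics.StatisticalMechanics
open Literature.Geometry.DiscreteGeometry (ShellCloseTo fccKissingPattern hcpKissingPattern EtaMatched
  card_eq_twelve_of_shellCloseTo)
open Summit.AtomisticToContinuum.Crystallization.Theorems.OverbindingBudgetWallTensionLever (CleanT TouchT Linked
  SealedDense MAT ThinCores BarlowClose)
open Summit.AtomisticToContinuum.Crystallization.Theorems.OverbindingBudgetViolatorDensityFloor (GT RT)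
open Summit.AtomisticToContinuum.Crystallization.Theorems.OverbindingBudgetGradedBareness (cleanT_anti)
open Summit.AtomisticToContinuum.Crystallization.Theorems.OverbindingBudgetCleanlessCut (margin_le_of_cleanT)
open Summit.AtomisticToContinuum.Crystallization.Theorems.OverbindingBudgetRecurrentSealStatements

/-! ## §K  The limit-stable forms of the hypotheses of laws 5 and 3 -/

/-- **Loosened thin cores** (the limit-stable form of `ThinCores a r`): within `r` of every point there is a site that is
LOOSENED-clean Barlow at every loosening `s ∈ (0, 1/100)` (`CleanT a (-s)`: twelve neighbours within `1.02 a`, all other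
sites beyond `1.26 a - s`, none closer than `0.98 a - s`, rescaled shell `(1/5 + s)`-close to a kissing pattern).  An exactly
gapped-twelve Barlow-close site (`GT ∧ BarlowClose = CleanT a 0`) is such a site (§L). -/
def ThinCoresL (a r : ℝ) (Y : Set (EuclideanSpace ℝ (Fin 3))) : Prop :=
  ∀ z : (EuclideanSpace ℝ (Fin 3)), ∃ y ∈ Y, dist z y ≤ r ∧ ∀ s : ℝ, 0 < s → s < 1 / 100 → CleanT a (-s) Y y

/-- A perfect Barlow packing at spacing `a` (verbatim the developability clause of laws 3 and 5): every point has exactly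
twelve others at distance exactly `a`, none closer, all others beyond `7a/5`, and its rescaled contact shell IS a kissing
pattern (fcc or hcp) up to a linear isometry. -/
def PerfectBarlow (a : ℝ) (W : Set (EuclideanSpace ℝ (Fin 3))) : Prop :=
  ∀ w ∈ W, ({v ∈ W | v ≠ w ∧ dist w v ≤ a}.ncard = 12 ∧ (∀ v ∈ W, v ≠ w → a ≤ dist w v ∧ (dist w v ≤ a ∨ a * (7 / 5) ≤ dist w v)) ∧
    (∃ T : Finset (EuclideanSpace ℝ (Fin 3)), (↑T : Set (EuclideanSpace ℝ (Fin 3))) = (fun v => a⁻¹ • (v - w)) '' {v ∈ W | v ≠ w ∧ dist w v ≤ a} ∧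
      (ShellCloseTo 0 T fccKissingPattern ∨ ShellCloseTo 0 T hcpKissingPattern)))

/-- **Developability** of a finite set `S` at spacing `a` (verbatim): an injection of `S` into a perfect Barlow packing that
preserves AND reflects contacts at threshold `1.02 a`.  It depends on `S` only through its contact graph. -/
def Developable (a : ℝ) (S : Finset (EuclideanSpace ℝ (Fin 3))) : Prop :=
  ∃ W : Set (EuclideanSpace ℝ (Fin 3)), PerfectBarlow a W ∧ ∃ u : (EuclideanSpace ℝ (Fin 3)) → (EuclideanSpace ℝ (Fin 3)),
    Set.InjOn u (↑S : Set (EuclideanSpace ℝ (Fin 3))) ∧ (∀ y ∈ S, u y ∈ W) ∧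
    ∀ y ∈ S, ∀ y' ∈ S, ((y ≠ y' ∧ dist y y' ≤ a * (1 + 1 / 50)) ↔ (u y ≠ u y' ∧ dist (u y) (u y') ≤ a * (1 + 1 / 50)))

/-- **Burgers-free** (verbatim the clause of law 5): every finite set of `t`-robustly clean sites, any `t > 0`, is developable. -/
def BurgersFree (a : ℝ) (Y : Set (EuclideanSpace ℝ (Fin 3))) : Prop :=
  ∀ t : ℝ, 0 < t → ∀ S : Finset (EuclideanSpace ℝ (Fin 3)), (↑S : Set (EuclideanSpace ℝ (Fin 3))) ⊆ Y → (∀ y ∈ S, CleanT a t Y y) → Developable a S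

/-- **Loosened unsealedness** (the limit-stable form of law 5's unsealedness clause): two `t`-robustly clean sites closer than
`W` are joined by a contact path of `≤ P` steps through LOOSENED-clean sites, at every loosening `t' ∈ (t, a/50]`. -/
def UnsealedL (a W : ℝ) (P : ℕ) (Y : Set (EuclideanSpace ℝ (Fin 3))) : Prop :=
  ∀ t : ℝ, 0 < t → ∀ t' : ℝ, t < t' → t' ≤ a / 50 → ∀ y ∈ Y, ∀ y' ∈ Y, CleanT a t Y y → CleanT a t Y y' → dist y y' < W →
    Linked a (-t') P Y y y'

/-- **Robust violators, `L`-densely, at every margin below `t`** (the limit-stable form of law 5's violator clause; `RT a s` is the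
`s`-relaxed gapped-twelve test of `…ViolatorDensityFloor`). -/
def ViolatorsL (a t L : ℝ) (Y : Set (EuclideanSpace ℝ (Fin 3))) : Prop :=
  ∀ q ∈ Y, ∃ y ∈ Y, dist y q ≤ L ∧ ∀ s : ℝ, 0 < s → s < t → ¬ RT a s Y y

/-- **Robust Burgers circuits, `L`-densely** (the limit-stable form of law 3's clause, with the radius `L` and size bound `M` as
parameters): within `L` of every site an undevelopable set of `≤ M` sites, clean at every margin `s ∈ (0, t)`. -/
def BurgersDenseL (a t L M : ℝ) (Y : Set (EuclideanSpace ℝ (Fin 3))) : Prop :=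
  ∀ p ∈ Y, ∃ S : Finset (EuclideanSpace ℝ (Fin 3)), (↑S : Set (EuclideanSpace ℝ (Fin 3))) ⊆ Y ∧ (S.card : ℝ) ≤ M ∧ (∀ y ∈ S, dist y p ≤ L) ∧
    (∀ s : ℝ, 0 < s → s < t → ∀ y ∈ S, CleanT a s Y y) ∧ ¬ Developable a S

/-! ## §K (ii)  Laws 5 and 3 on their extremal class -/

/-- **`RecurrentDustLaw` — law 5 (`DustLaw`) on its extremal class.**  For the limiting energy density `e`: every uniformly
discrete, ROOTED, UNIFORMLY RECURRENT, `9/10`-covering texture that, at a spacing `a ∈ [47/50, 1]`, has loosened thin cores of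
radius `10`, is Burgers-free and loosened-unsealed (width `24`, `48` steps), and carries `L`-dense `t`-robust violators of the
gapped-twelve test, has cubes of arbitrarily large side with site charge `∑ (φ_Y − 2e) > η ℓ³` for one `η > 0`.  No `MAT`. -/
def RecurrentDustLaw : Prop :=
  ∀ e : ℝ, Filter.Tendsto (fun N : ℕ => groundStateEnergy lennardJones 3 N / N) Filter.atTop (nhds e) →
    (∀ N : ℕ, 0 < N → e ≤ groundStateEnergy lennardJones 3 N / N) →
    ∀ Y : Set (EuclideanSpace ℝ (Fin 3)), UniformlyDiscrete Y → (0 : (EuclideanSpace ℝ (Fin 3))) ∈ Y → UniformlyRecurrent Y →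
      (∀ z : (EuclideanSpace ℝ (Fin 3)), ∃ w ∈ Y, dist z w ≤ 9 / 10) →
      ∀ a : ℝ, 47 / 50 ≤ a → a ≤ 1 → ∀ t : ℝ, 0 < t → ∀ L : ℝ, ThinCoresL a 10 Y → BurgersFree a Y → UnsealedL a 24 48 Y →
        (∀ q ∈ Y, ∃ y ∈ Y, dist y q ≤ L ∧ ¬ RT a t Y y) →
        ∃ η : ℝ, 0 < η ∧ ∀ ℓ₀ : ℝ, ∃ ℓ : ℝ, ∃ c : (EuclideanSpace ℝ (Fin 3)), ∃ F : Finset (EuclideanSpace ℝ (Fin 3)), ℓ₀ ≤ ℓ ∧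
          (↑F : Set (EuclideanSpace ℝ (Fin 3))) = Y ∩ {z | ∀ i : Fin 3, c i ≤ z i ∧ z i < c i + ℓ} ∧
          η * ℓ ^ 3 < ∑ y ∈ F, ((∑' w : ↥Y, lennardJones (dist y (w : (EuclideanSpace ℝ (Fin 3))))) - 2 * e)

/-- **`RecurrentDislocationLaw` — law 3 (`DislocationLaw`) on its extremal class.**  Same world, with `L`-dense undevelopable
`t`-robustly clean sets of `≤ M` sites (robust Burgers circuits) instead of the dust clauses.  No `MAT`. -/
def RecurrentDislocationLaw : Prop :=
  ∀ e : ℝ, Filter.Tendsto (fun N : ℕ => groundStateEnergy lennardJones 3 N / N) Filter.atTop (nhds e) →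
    (∀ N : ℕ, 0 < N → e ≤ groundStateEnergy lennardJones 3 N / N) →
    ∀ Y : Set (EuclideanSpace ℝ (Fin 3)), UniformlyDiscrete Y → (0 : (EuclideanSpace ℝ (Fin 3))) ∈ Y → UniformlyRecurrent Y →
      (∀ z : (EuclideanSpace ℝ (Fin 3)), ∃ w ∈ Y, dist z w ≤ 9 / 10) →
      ∀ a : ℝ, 47 / 50 ≤ a → a ≤ 1 → ∀ t : ℝ, 0 < t → ThinCoresL a 10 Y →
        (∃ L M : ℝ, ∀ p ∈ Y, ∃ S : Finset (EuclideanSpace ℝ (Fin 3)), (↑S : Set (EuclideanSpace ℝ (Fin 3))) ⊆ Y ∧ (S.card : ℝ) ≤ M ∧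
          (∀ y ∈ S, dist y p ≤ L) ∧ (∀ y ∈ S, CleanT a t Y y) ∧ ¬ Developable a S) →
        ∃ η : ℝ, 0 < η ∧ ∀ ℓ₀ : ℝ, ∃ ℓ : ℝ, ∃ c : (EuclideanSpace ℝ (Fin 3)), ∃ F : Finset (EuclideanSpace ℝ (Fin 3)), ℓ₀ ≤ ℓ ∧
          (↑F : Set (EuclideanSpace ℝ (Fin 3))) = Y ∩ {z | ∀ i : Fin 3, c i ≤ z i ∧ z i < c i + ℓ} ∧
          η * ℓ ^ 3 < ∑ y ∈ F, ((∑' w : ↥Y, lennardJones (dist y (w : (EuclideanSpace ℝ (Fin 3))))) - 2 * e)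

/-! ## §K (iii)  The hull families of the two reductions -/

/-- The hull family of the law-5 reduction: rooted, `δ`-separated, `9/10`-covering textures with loosened thin cores,
Burgers-free, loosened-unsealed, with robust violators at every margin below `t`, flat with modulus `m`. -/
def HullDust (δ a t L e : ℝ) (m : ℝ → ℝ) : Set (Set (EuclideanSpace ℝ (Fin 3))) :=
  {Z | (0 : (EuclideanSpace ℝ (Fin 3))) ∈ Z ∧ (∀ p ∈ Z, ∀ q ∈ Z, p ≠ q → δ ≤ dist p q) ∧
    (∀ z : (EuclideanSpace ℝ (Fin 3)), ∃ w ∈ Z, dist z w ≤ 9 / 10) ∧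
    ThinCoresL a 10 Z ∧ BurgersFree a Z ∧ UnsealedL a 24 48 Z ∧ ViolatorsL a t L Z ∧ FlatMod e m Z}

/-- Unfolding of `HullDust`. -/
theorem mem_hullDust {δ a t L e : ℝ} {m : ℝ → ℝ} {Z : Set (EuclideanSpace ℝ (Fin 3))} :
    Z ∈ HullDust δ a t L e m ↔ (0 : (EuclideanSpace ℝ (Fin 3))) ∈ Z ∧ (∀ p ∈ Z, ∀ q ∈ Z, p ≠ q → δ ≤ dist p q) ∧
      (∀ z : (EuclideanSpace ℝ (Fin 3)), ∃ w ∈ Z, dist z w ≤ 9 / 10) ∧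
      ThinCoresL a 10 Z ∧ BurgersFree a Z ∧ UnsealedL a 24 48 Z ∧ ViolatorsL a t L Z ∧ FlatMod e m Z :=
  Iff.rfl

/-- The hull family of the law-3 reduction: rooted, `δ`-separated, `9/10`-covering textures with loosened thin cores and
`L`-dense robust Burgers circuits of `≤ M` sites, flat with modulus `m`. -/
def HullBurgers (δ a t L M e : ℝ) (m : ℝ → ℝ) : Set (Set (EuclideanSpace ℝ (Fin 3))) :=
  {Z | (0 : (EuclideanSpace ℝ (Fin 3))) ∈ Z ∧ (∀ p ∈ Z, ∀ q ∈ Z, p ≠ q → δ ≤ dist p q) ∧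
    (∀ z : (EuclideanSpace ℝ (Fin 3)), ∃ w ∈ Z, dist z w ≤ 9 / 10) ∧
    ThinCoresL a 10 Z ∧ BurgersDenseL a t L M Z ∧ FlatMod e m Z}

/-- Unfolding of `HullBurgers`. -/
theorem mem_hullBurgers {δ a t L M e : ℝ} {m : ℝ → ℝ} {Z : Set (EuclideanSpace ℝ (Fin 3))} :
    Z ∈ HullBurgers δ a t L M e m ↔ (0 : (EuclideanSpace ℝ (Fin 3))) ∈ Z ∧ (∀ p ∈ Z, ∀ q ∈ Z, p ≠ q → δ ≤ dist p q) ∧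
      (∀ z : (EuclideanSpace ℝ (Fin 3)), ∃ w ∈ Z, dist z w ≤ 9 / 10) ∧
      ThinCoresL a 10 Z ∧ BurgersDenseL a t L M Z ∧ FlatMod e m Z :=
  Iff.rfl

/-! ## §L  Margins: from the registered clauses to the limit-stable ones -/

/-- Windows of a uniformly discrete texture are finite. [folklore] -/
theorem window_finite {Y : Set (EuclideanSpace ℝ (Fin 3))} (hY : UniformlyDiscrete Y) (y : (EuclideanSpace ℝ (Fin 3))) (r : ℝ) :
    {w ∈ Y | w ≠ y ∧ dist y w ≤ r}.Finite :=
  (UniformlyDiscrete.finite_inter_closedBall (X := Y) hY y r).subset fun w hw =>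
    ⟨hw.1, mem_closedBall.2 (by rw [dist_comm]; exact hw.2.2)⟩

/-- Open windows of a uniformly discrete texture are finite. [folklore] -/
theorem window_finite_lt {Y : Set (EuclideanSpace ℝ (Fin 3))} (hY : UniformlyDiscrete Y) (y : (EuclideanSpace ℝ (Fin 3))) (r : ℝ) :
    {w ∈ Y | w ≠ y ∧ dist y w < r}.Finite :=
  (UniformlyDiscrete.finite_inter_closedBall (X := Y) hY y r).subset fun w hw =>
    ⟨hw.1, mem_closedBall.2 (by rw [dist_comm]; exact hw.2.2.le)⟩

/-- The relaxed gapped-twelve test is monotone in the margin: relaxing more keeps a pass. -/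
theorem rt_mono {a s t : ℝ} {Y : Set (EuclideanSpace ℝ (Fin 3))} {y : (EuclideanSpace ℝ (Fin 3))} (hY : UniformlyDiscrete Y)
    (hst : s ≤ t) (h : RT a s Y y) : RT a t Y y := by
  obtain ⟨h1, h2, h3⟩ := h
  refine ⟨?_, ?_, fun w hw hwy => ?_⟩
  · refine le_trans (Set.ncard_le_ncard (fun w hw => ?_) (window_finite_lt hY y _)) h1
    exact ⟨hw.1, hw.2.1, by linarith [hw.2.2]⟩
  · refine h2.trans (Set.ncard_le_ncard (fun w hw => ?_) (window_finite hY y _))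
    exact ⟨hw.1, hw.2.1, by linarith [hw.2.2]⟩
  · obtain ⟨hlo, hdich⟩ := h3 w hw hwy
    exact ⟨by linarith, hdich.imp (fun h => by linarith) (fun h => by linarith)⟩

/-- Exact cleanness is the gapped-twelve test together with `1/5`-Barlow-closeness. -/
theorem cleanT_zero_iff {a : ℝ} {Y : Set (EuclideanSpace ℝ (Fin 3))} {y : (EuclideanSpace ℝ (Fin 3))} :
    CleanT a 0 Y y ↔ (GT a Y y ∧ BarlowClose a Y y) := by
  unfold CleanT GT BarlowClose
  simp only [sub_zero, add_zero]
  exact and_assoc.symm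

/-- Exact thin cores are loosened thin cores (`GT ∧ BarlowClose = CleanT a 0`, then antitonicity of `CleanT` in the margin). -/
theorem thinCoresL_of_thinCores {a r : ℝ} {Y : Set (EuclideanSpace ℝ (Fin 3))} (ha : 47 / 50 ≤ a) (h : ThinCores a r Y) :
    ThinCoresL a r Y := by
  intro z
  obtain ⟨y, hy, hGT, hB, hd⟩ := h z
  refine ⟨y, hy, hd, fun s hs hs1 => ?_⟩
  exact cleanT_anti (by linarith) (by linarith) (by linarith) (cleanT_zero_iff.2 ⟨hGT, hB⟩)

/-- Unsealedness at the pair's own margin (law 5's clause) gives loosened unsealedness (`Linked` is antitone in the margin). -/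
theorem unsealedL_of_unsealed {a W : ℝ} {P : ℕ} {Y : Set (EuclideanSpace ℝ (Fin 3))}
    (h : ∀ t : ℝ, 0 < t → ∀ y ∈ Y, ∀ y' ∈ Y, CleanT a t Y y → CleanT a t Y y' → dist y y' ≤ W → Linked a (-t) P Y y y') :
    UnsealedL a W P Y := by
  intro t ht t' htt' ht'a y hy y' hy' hc hc' hd
  exact linked_anti (by linarith [ht, htt', ht'a]) (by linarith [ht'a]) (by linarith [htt']) (h t ht y hy y' hy' hc hc' hd.le)

/-- Robust violators at margin `t` (law 5's clause) are robust violators at every margin below `t`. -/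
theorem violatorsL_of_violators {a t L : ℝ} {Y : Set (EuclideanSpace ℝ (Fin 3))} (hY : UniformlyDiscrete Y)
    (h : ∀ q ∈ Y, ∃ y ∈ Y, dist y q ≤ L ∧ ¬ RT a t Y y) : ViolatorsL a t L Y := by
  intro q hq
  obtain ⟨y, hy, hd, hn⟩ := h q hq
  exact ⟨y, hy, hd, fun s hs hst hRT => hn (rt_mono hY hst.le hRT)⟩

/-- `L`-dense robust Burgers circuits at margin `t` (law 3's clause) are clean at every margin below `t`. -/
theorem burgersDenseL_of_dense {a t L M : ℝ} {Y : Set (EuclideanSpace ℝ (Fin 3))} (ha : 47 / 50 ≤ a)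
    (h : ∀ p ∈ Y, ∃ S : Finset (EuclideanSpace ℝ (Fin 3)), (↑S : Set (EuclideanSpace ℝ (Fin 3))) ⊆ Y ∧ (S.card : ℝ) ≤ M ∧
      (∀ y ∈ S, dist y p ≤ L) ∧ (∀ y ∈ S, CleanT a t Y y) ∧ ¬ Developable a S) :
    BurgersDenseL a t L M Y := by
  intro p hp
  obtain ⟨S, hSY, hM, hL, hcl, hnd⟩ := h p hp
  exact ⟨S, hSY, hM, hL, fun s hs hst y hy => cleanT_anti (by linarith) (by linarith) hst.le (hcl y hy), hnd⟩

/-! ## §M  Translation covariance of the new conditions -/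

/-- open windows of the re-rooted texture are translated open windows -/
theorem window_translate_lt (Y : Set (EuclideanSpace ℝ (Fin 3))) (v y : (EuclideanSpace ℝ (Fin 3))) (r : ℝ) :
    {w ∈ (fun p => p - v) '' Y | w ≠ y - v ∧ dist (y - v) w < r} =
      (fun p => p - v) '' {w ∈ Y | w ≠ y ∧ dist y w < r} := by
  ext w
  simp only [Set.mem_setOf_eq, Set.mem_image]
  constructor
  · rintro ⟨⟨p, hp, rfl⟩, hne, hd⟩
    refine ⟨p, ⟨hp, fun heq => hne (by rw [heq]), ?_⟩, rfl⟩
    rwa [dist_sub_right] at hd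
  · rintro ⟨p, ⟨hp, hne, hd⟩, rfl⟩
    exact ⟨⟨p, hp, rfl⟩, fun heq => hne (sub_left_injective heq), by rwa [dist_sub_right]⟩

/-- Re-rooting preserves the relaxed gapped-twelve test. [folklore] -/
theorem rt_translate {a s : ℝ} {Y : Set (EuclideanSpace ℝ (Fin 3))} {y : (EuclideanSpace ℝ (Fin 3))} (v : (EuclideanSpace ℝ (Fin 3)))
    (h : RT a s Y y) : RT a s ((fun p => p - v) '' Y) (y - v) := by
  obtain ⟨h1, h2, h3⟩ := h
  refine ⟨?_, ?_, ?_⟩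
  · rw [window_translate_lt, Set.ncard_image_of_injective _ sub_left_injective]; exact h1
  · rw [window_translate, Set.ncard_image_of_injective _ sub_left_injective]; exact h2
  · rintro _ ⟨w, hw, rfl⟩ hne
    rw [dist_sub_right]
    exact h3 w hw fun heq => hne (by rw [heq])

/-- Re-rooting preserves loosened thin cores. [folklore] -/
theorem thinCoresL_translate {a r : ℝ} {Y : Set (EuclideanSpace ℝ (Fin 3))} (v : (EuclideanSpace ℝ (Fin 3))) (h : ThinCoresL a r Y) :
    ThinCoresL a r ((fun p => p - v) '' Y) := by
  intro z
  obtain ⟨y, hy, hd, hcl⟩ := h (z + v)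
  refine ⟨y - v, ⟨y, hy, rfl⟩, ?_, fun s hs hs1 => cleanT_translate v (hcl s hs hs1)⟩
  have e : dist z (y - v) = dist (z + v) y := by rw [← dist_sub_right (z + v) y v, add_sub_cancel_right]
  rw [e]; exact hd

/-- A distance-preserving map of the ambient space pulls developability back along the image: developability depends on a
finite set only through its contact graph. [folklore] -/
theorem developable_of_image {a : ℝ} {S : Finset (EuclideanSpace ℝ (Fin 3))} {f : (EuclideanSpace ℝ (Fin 3)) → (EuclideanSpace ℝ (Fin 3))}
    (hf : ∀ x z : (EuclideanSpace ℝ (Fin 3)), dist (f x) (f z) = dist x z) (h : Developable a (S.image f)) : Developable a S := by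
  classical
  have hinjf : Function.Injective f := fun x z hxz => by
    have h1 := hf x z
    rw [hxz, dist_self] at h1
    exact dist_eq_zero.1 h1.symm
  obtain ⟨W, hW, u, hinj, huW, hiff⟩ := h
  refine ⟨W, hW, fun p => u (f p), fun y hy y' hy' heq => ?_, fun y hy => huW _ (Finset.mem_image_of_mem f hy), fun y hy y' hy' => ?_⟩
  · exact hinjf (hinj (Finset.mem_coe.2 (Finset.mem_image_of_mem f hy)) (Finset.mem_coe.2 (Finset.mem_image_of_mem f hy')) heq)
  · have h1 := hiff (f y) (Finset.mem_image_of_mem f hy) (f y') (Finset.mem_image_of_mem f hy')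
    rw [hf y y', hinjf.ne_iff] at h1
    exact h1

/-- the inverse translation undoes a translated image -/
theorem image_sub_image_add (S : Finset (EuclideanSpace ℝ (Fin 3))) (v : (EuclideanSpace ℝ (Fin 3))) :
    (S.image (fun p => p - v)).image (fun p => p + v) = S := by
  classical
  rw [Finset.image_image]
  have : ((fun p : (EuclideanSpace ℝ (Fin 3)) => p + v) ∘ (fun p => p - v)) = id := by funext p; simp
  rw [this, Finset.image_id]

/-- Re-rooting preserves developability (both directions). [folklore] -/
theorem developable_image_sub_iff {a : ℝ} {S : Finset (EuclideanSpace ℝ (Fin 3))} (v : (EuclideanSpace ℝ (Fin 3))) :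
    Developable a (S.image (fun p => p - v)) ↔ Developable a S := by
  classical
  constructor
  · exact developable_of_image fun x z => dist_sub_right x z v
  · intro h
    refine developable_of_image (f := fun p => p + v) (fun x z => dist_add_right x z v) ?_
    rw [image_sub_image_add]; exact h

/-- Re-rooting preserves Burgers-freeness. [folklore] -/
theorem burgersFree_translate {a : ℝ} {Y : Set (EuclideanSpace ℝ (Fin 3))} (v : (EuclideanSpace ℝ (Fin 3))) (h : BurgersFree a Y) :
    BurgersFree a ((fun p => p - v) '' Y) := by
  classical
  intro t ht S hSY hcl
  have hS' : (↑(S.image (fun p => p + v)) : Set (EuclideanSpace ℝ (Fin 3))) ⊆ Y := by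
    rw [Finset.coe_image]
    rintro _ ⟨y, hy, rfl⟩
    exact mem_translate.1 (hSY hy)
  have hcl' : ∀ y ∈ S.image (fun p => p + v), CleanT a t Y y := by
    intro x hx
    rw [Finset.mem_image] at hx
    obtain ⟨y, hy, rfl⟩ := hx
    have := cleanT_translate (-v) (hcl y hy)
    rwa [translate_translate, sub_neg_eq_add] at this
  exact developable_of_image (f := fun p => p + v) (fun x z => dist_add_right x z v) (h t ht _ hS' hcl')

/-- Re-rooting preserves loosened unsealedness. [folklore] -/
theorem unsealedL_translate {a W : ℝ} {P : ℕ} {Y : Set (EuclideanSpace ℝ (Fin 3))} (v : (EuclideanSpace ℝ (Fin 3))) (h : UnsealedL a W P Y) :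
    UnsealedL a W P ((fun p => p - v) '' Y) := by
  intro t ht t' htt' ht'a y hy y' hy' hc hc' hd
  rw [mem_translate] at hy hy'
  have hc₁ : CleanT a t Y (y + v) := by
    have := cleanT_translate (-v) hc; rwa [translate_translate, sub_neg_eq_add] at this
  have hc₂ : CleanT a t Y (y' + v) := by
    have := cleanT_translate (-v) hc'; rwa [translate_translate, sub_neg_eq_add] at this
  have hL := h t ht t' htt' ht'a (y + v) hy (y' + v) hy' hc₁ hc₂ (by rwa [dist_add_right])
  have := linked_translate v hL
  rwa [add_sub_cancel_right, add_sub_cancel_right] at this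

/-- Re-rooting preserves robust violators at every margin below `t`. [folklore] -/
theorem violatorsL_translate {a t L : ℝ} {Y : Set (EuclideanSpace ℝ (Fin 3))} (v : (EuclideanSpace ℝ (Fin 3))) (h : ViolatorsL a t L Y) :
    ViolatorsL a t L ((fun p => p - v) '' Y) := by
  intro q hq
  rw [mem_translate] at hq
  obtain ⟨y, hy, hd, hn⟩ := h (q + v) hq
  refine ⟨y - v, ⟨y, hy, rfl⟩, ?_, fun s hs hst hRT => hn s hs hst ?_⟩
  · have e : dist (y - v) q = dist y (q + v) := by rw [← dist_sub_right y (q + v) v, add_sub_cancel_right]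
    rw [e]; exact hd
  · have := rt_translate (-v) hRT
    rwa [translate_translate, sub_neg_eq_add, sub_add_cancel] at this

/-- Re-rooting preserves `L`-dense robust Burgers circuits. [folklore] -/
theorem burgersDenseL_translate {a t L M : ℝ} {Y : Set (EuclideanSpace ℝ (Fin 3))} (v : (EuclideanSpace ℝ (Fin 3))) (h : BurgersDenseL a t L M Y) :
    BurgersDenseL a t L M ((fun p => p - v) '' Y) := by
  classical
  intro p hp
  rw [mem_translate] at hp
  obtain ⟨S, hSY, hM, hL, hcl, hnd⟩ := h (p + v) hp
  refine ⟨S.image (fun q => q - v), ?_, ?_, ?_, ?_, fun hD => hnd ((developable_image_sub_iff v).1 hD)⟩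
  · rw [Finset.coe_image]; exact Set.image_mono hSY
  · rw [Finset.card_image_of_injective _ sub_left_injective]; exact hM
  · intro x hx
    rw [Finset.mem_image] at hx
    obtain ⟨y, hy, rfl⟩ := hx
    have e : dist (y - v) p = dist y (p + v) := by rw [← dist_sub_right y (p + v) v, add_sub_cancel_right]
    rw [e]; exact hL y hy
  · intro s hs hst x hx
    rw [Finset.mem_image] at hx
    obtain ⟨y, hy, rfl⟩ := hx
    exact cleanT_translate v (hcl s hs hst y hy)

end Summit.AtomisticToContinuum.Crystallization.Theorems.OverbindingBudgetRecurrentDustStatements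

end
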